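import Summits.KontsevichZagierPeriods.Zeta5Search.RVFlatGaugeLargeParam
import HarnessLib

/-!
# RVLargeParamVFloor — the large-parameter class law (CV⁺) REDUCED to a constant-term floor (V⁺) (fam-rv gen 9, file 1)

HONEST FRAMING: systematic search; no irrationality claim unless certified.  This file MINTS ONE CONJECTURE NODE
(`LargeParamVFloor`, tagged `@[conjecture]`, found by exact computation in this cell — NOT a published result, used below only as
an explicit hypothesis) and PROVES that it implies gen-8's node `LargeParamClassLaw` (CV⁺), hence the flat `S₇`-gauge law on the
whole region {at most one long block, `b₀ < 3p`} (`FlatGaugeLawF1`).  `p`-adic valuations of rational numbers only; no γ / measure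
claim; nothing about irrationality.

WHERE THIS SITS.  `RVFlatGaugeLargeParam.lean` (gen 8, file 5) observed the large-parameter class law
    `v_p C_j(b) ≥ min(1,⌊d/p⌋) − N_p(b) + δ(b,p)`,   `δ = min(nbig, [LP] + [2p ≤ d])`                         (CV⁺)
for the Casoratians `C_j(b) = W(b+e_j)V(b) − W(b)V(b+e_j)` and proved (CV⁺) ⇒ FLAT ∀σ on (F1).  The gen-9 FIRST DIAGNOSTIC
(exact arithmetic; `pub-zeta5-fam-rv/gen9/rv9_rowdiag.py`, `rv9_vclass.py`, `rv9_vlaw.py`) located the bonus `δ`: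
it is NOT in the `𝒦`-residues (`v_p 𝒦_x` stays at `1`, the single-row level of `singleRowLaw_holds`) but ENTIRELY IN THE
CONSTANT TERM: in all 6,485 one-long-block deep instances `(b,p)`, `b₀ ≤ 16`, and all 1,363 instances with `δ ≥ 1`, `b₀ ≤ 18`,
    `v_p V(b) ≥ −N_p(b) + δ(b,p)`   and   `v_p V(b+e_j) ≥ −N_p(b) + δ(b,p)`,                                        (V⁺)
with equality in `V(b)` in the overwhelming majority (e.g. 6,112 of 6,300 instances with `b₀ < 3p`) — i.e. (V⁺) is THEOREM V
(`constantTermFloorLaw_window`: `v_p V ≥ −N_p`) sharpened by exactly the (CV⁺) bonus, and every residue-class row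
`𝒦_x(b⁺)V(b) − 𝒦_x(b)V(b⁺)` of the `𝒦`-bracket then already carries `1 − N_p + δ` (0 row failures in 1,363 instances).

THE OBSERVED LAW (V⁺) (`LargeParamVFloor`): for `b` and `b + e_j` in the polytope, `p ≥ 5` prime, `b₀ + 2 < p²`, at most one
long block: `v_p V(b) ≥ −N_p(b) + δ(b,p)` and `v_p V(b+e_j) ≥ −N_p(b) + δ(b,p)` (whenever the constant term is non-zero).
EVIDENCE (exact rational arithmetic; certificate `pub-zeta5-fam-rv/gen9/rv9_vplus_cert.py`, output `gen9/out/vplus_cert_*.json`):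
0 failures over every `b` with `b₀ ≤ 19` and EVERY prime `5 ≤ p ≤ m₁(b)` with at most one long block (for `p > m₁(b)` one has
`nbig = N_p = δ = 0` and the claim is THEOREM V); `V(b+e_j)` certified for every admissible `j` (directly for `b₀ ≤ 12`, where the
identity `V(b+e_j) = V((t+c)²R_b) − (c−1−b_j)² V(b)`, `c = (b₀+2)/2`, is re-verified exactly, and through it above).
For `nbig = 0` (all `b_k < p`) (V⁺) IS THEOREM V (`largeParamVFloor_small` below).

THE REDUCTION (PROVED here, gen-2 g8's road verbatim with the sharper constant-term bound):
* `ClusterValuation.kBracket_bound_of_vBonus` — with single-pole classes, `‖𝒦_x‖ ≤ p⁻¹` (`padicNorm_classK_le_of_le_one`) and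
  `‖V(b)‖, ‖V(b⁺)‖ ≤ p^{N_p − δ}` give `v_p(𝒦-bracket) ≥ 1 − N_p + δ`;
* `ClusterValuation.casoratianLaw_of_vBonus` — `casoratian_split`, `Ω_p = 0` for `p ≤ d+1` (`omegaRes_eq_zero`), `Ω_p`
  `p`-integral otherwise: `v_p C_j(b) ≥ min(1,⌊d/p⌋) − N_p + δ` for ANY bonus `δ` carried by both constant terms;
* `largeParamClassLaw_of_vFloor : LargeParamVFloor → LargeParamClassLaw` and
  `flatGaugeLawF1_of_vFloor : LargeParamVFloor → FlatGaugeLawF1`.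
So frontier (F1) of the flat `S₇`-gauge law is now ONE statement about ONE eight-parameter constant term `V(b)` (no Casoratian,
no second parameter vector beyond the contiguous shift).

(V⁺) IS PROVED OUTSIDE A SMALL RESIDUAL SET in the companion files `RVLargeParamVULayer.lean` (the U-LAYER case: level-one
layer expansion, reflection antisymmetry, THEOREM C for `U`) and `RVLargeParamVCases.lean` (the COUNTING and PALINDROMIC cases, the
residual node `LargeParamVResidual` — 34 of the 77,272 pairs `(c,p)`, `c ∈ {b, b+e_j}`, over all deep one-long-block instances with
`b₀ ≤ 19`; 99 of 266,605 with `b₀ ≤ 22` — and `LargeParamVResidual → LargeParamVFloor`).  With at most one long block every pole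
class has at most one pole and every partial-fraction coefficient of `R_b` at such a pole is `p`-integral (Theorem A′), so modulo
`ℤ_(p)` the constant term is a sum of `p`-power LAYERS of residue sums; (V⁺) is a digit cancellation in these layers.
-/

noncomputable section

open Finset

namespace Summit.KontsevichZagierPeriods.Zeta5Search.ClusterValuation

open Summit.KontsevichZagierPeriods.Zeta5Search.WedgeDictionary (coeffV dOf)
open Summit.KontsevichZagierPeriods.Zeta5Search.CasoratianValuation (InPolytope pairFloors refund shift casoratian)
open Summit.KontsevichZagierPeriods.Zeta5Search.PadicSeries

variable {p : ℕ} [hp : Fact p.Prime]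

/-! ### (CV) with a constant-term bonus (gen-2 g8's road, parametrised) -/

/-- **The `𝒦`-bracket with a `V`-bonus**: at a prime without multipole classes, if `‖V(b)‖_p, ‖V(b+e_j)‖_p ≤ p^{N_p(b) − δ}` then
`v_p(𝒦_p(b⁺)V(b) − 𝒦_p(b)V(b⁺)) ≥ 1 − N_p(b) + δ` (each single-pole row has `‖𝒦_x‖_p ≤ p⁻¹`). -/
theorem kBracket_bound_of_vBonus (b : ℕ → ℤ) {j : ℕ} (hb : InPolytope b) (hj1 : 1 ≤ j)
    (hb' : InPolytope (shift b j)) (hp5 : 5 ≤ p) (hwin : (b 0 + 2 : ℤ) < (p : ℤ) ^ 2)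
    (hno : ∀ x, x < p → classPoleCount b p x ≤ 1) {δ : ℤ}
    (hVb : padicNorm p (coeffV b) ≤ (p : ℚ) ^ (pairFloors b p - δ))
    (hVb' : padicNorm p (coeffV (shift b j)) ≤ (p : ℚ) ^ (pairFloors b p - δ))
    (hne : kRes (shift b j) p * coeffV b - kRes b p * coeffV (shift b j) ≠ 0) :
    1 - pairFloors b p + δ ≤ padicValRat p (kRes (shift b j) p * coeffV b - kRes b p * coeffV (shift b j)) := by
  have hp0 : 0 < p := hp.out.pos
  have hpq : (p : ℚ) ≠ 0 := Nat.cast_ne_zero.2 hp.out.ne_zero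
  have hwin' : (shift b j 0 + 2 : ℤ) < (p : ℤ) ^ 2 := by rwa [BigPrime.shift_zero b hj1]
  have hsplit : kRes (shift b j) p * coeffV b - kRes b p * coeffV (shift b j) =
      ∑ x ∈ range p, (classK (shift b j) p x * coeffV b - classK b p x * coeffV (shift b j)) := by
    rw [kRes_eq_sum_classK (shift b j) hp0, kRes_eq_sum_classK b hp0, sum_mul, sum_mul, ← sum_sub_distrib]
  have hexp : (-(1 - pairFloors b p + δ) : ℤ) = -1 + (pairFloors b p - δ) := by ring
  apply val_ge_of_padicNorm_le hne
  rw [hsplit]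
  refine padicNorm.sum_le' (fun x hx => ?_) (zpow_p_nonneg _)
  have hx' := mem_range.1 hx
  rcases Nat.eq_zero_or_pos (classPoleCount b p x) with hc | hc
  · have hc' : classPoleCount (shift b j) p x = 0 := by
      have := classPoleCount_shift_le b hb.1 hj1 p x; omega
    rw [classK_eq_zero_of_noPole b hb hc, classK_eq_zero_of_noPole (shift b j) hb' hc', zero_mul, zero_mul, sub_zero,
      padicNorm.zero]
    exact zpow_p_nonneg _
  · have hK : padicNorm p (classK b p x) ≤ (p : ℚ) ^ (-(1 : ℤ)) :=
      padicNorm_classK_le_of_le_one b hb hp5 hwin hx' (hno x hx')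
    have hK' : padicNorm p (classK (shift b j) p x) ≤ (p : ℚ) ^ (-(1 : ℤ)) :=
      padicNorm_classK_le_of_le_one (shift b j) hb' hp5 hwin' hx'
        ((classPoleCount_shift_le b hb.1 hj1 p x).trans (hno x hx'))
    rw [hexp, zpow_add₀ hpq]
    refine (padicNorm.sub (p := p)).trans (max_le ?_ ?_)
    · rw [padicNorm.mul]
      exact mul_le_mul hK' hVb (padicNorm.nonneg _) (zpow_p_nonneg _)
    · rw [padicNorm.mul]
      exact mul_le_mul hK hVb' (padicNorm.nonneg _) (zpow_p_nonneg _)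

/-- **(CV) with a constant-term bonus** (gen-2 g8's road, pointwise): at a prime without multipole classes, if both constant
terms satisfy `v_p V(b), v_p V(b+e_j) ≥ −N_p(b) + δ`, then `v_p C_j(b) ≥ min(1,⌊d/p⌋) − N_p(b) + δ`. -/
theorem casoratianLaw_of_vBonus (b : ℕ → ℤ) {j : ℕ} (hb : InPolytope b) (hj1 : 1 ≤ j) (hj7 : j ≤ 7)
    (hb' : InPolytope (shift b j)) (hp5 : 5 ≤ p) (hwin : (b 0 + 2 : ℤ) < (p : ℤ) ^ 2)
    (hno : ∀ x, x < p → classPoleCount b p x ≤ 1) (δ : ℤ)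
    (hV : coeffV b ≠ 0 → -pairFloors b p + δ ≤ padicValRat p (coeffV b))
    (hV' : coeffV (shift b j) ≠ 0 → -pairFloors b p + δ ≤ padicValRat p (coeffV (shift b j)))
    (hcas : casoratian b j ≠ 0) :
    refund b p - pairFloors b p + δ ≤ padicValRat p (casoratian b j) := by
  have hpp := hp.out
  have hp1 : (1 : ℚ) < p := by exact_mod_cast hpp.one_lt
  have hd0 : 0 ≤ dOf b := by
    have := hb.2.2; unfold dOf; linarith
  have hdshift : dOf (shift b j) = dOf b - 1 := BigPrime.dOf_shift b hj1 hj7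
  have hexp : (-(-pairFloors b p + δ) : ℤ) = pairFloors b p - δ := by ring
  have hVb : padicNorm p (coeffV b) ≤ (p : ℚ) ^ (pairFloors b p - δ) := by
    have h := padicNorm_le_of_val (p := p) hV; rwa [hexp] at h
  have hVb' : padicNorm p (coeffV (shift b j)) ≤ (p : ℚ) ^ (pairFloors b p - δ) := by
    have h := padicNorm_le_of_val (p := p) hV'; rwa [hexp] at h
  have hBb : padicNorm p (kRes (shift b j) p * coeffV b - kRes b p * coeffV (shift b j))
      ≤ (p : ℚ) ^ (-(1 - pairFloors b p + δ)) :=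
    padicNorm_le_of_val (fun h => kBracket_bound_of_vBonus b hb hj1 hb' hp5 hwin hno hVb hVb' h)
  have hΩint : ∀ b' : ℕ → ℤ, InPolytope b' → padicNorm p (omegaRes b' p) ≤ 1 := fun b' hb'' =>
    padicNorm_omegaRes_le_one b' hb'' (by omega)
  apply val_ge_of_padicNorm_le hcas
  rw [casoratian_split b j p]
  by_cases hpd : (p : ℤ) ≤ dOf b
  · rw [omegaRes_eq_zero b hb (by omega), omegaRes_eq_zero (shift b j) hb' (by rw [hdshift]; omega), zero_mul, zero_mul,
      sub_zero, zero_sub, padicNorm.neg]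
    refine hBb.trans (zpow_le_zpow_right₀ hp1.le ?_)
    have : refund b p ≤ 1 := min_le_left _ _
    linarith
  · have hr : refund b p = 0 := by
      unfold refund
      rw [Int.ediv_eq_zero_of_lt hd0 (by omega)]; simp
    have hexp' : (-(refund b p - pairFloors b p + δ) : ℤ) = pairFloors b p - δ := by rw [hr]; ring
    rw [hexp']
    refine (padicNorm.sub (p := p)).trans (max_le ((padicNorm.sub (p := p)).trans (max_le ?_ ?_)) ?_)
    · rw [padicNorm.mul]
      calc padicNorm p (omegaRes (shift b j) p) * padicNorm p (coeffV b) ≤ 1 * (p : ℚ) ^ (pairFloors b p - δ) :=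
            mul_le_mul (hΩint _ hb') hVb (padicNorm.nonneg _) zero_le_one
        _ = _ := one_mul _
    · rw [padicNorm.mul]
      calc padicNorm p (omegaRes b p) * padicNorm p (coeffV (shift b j)) ≤ 1 * (p : ℚ) ^ (pairFloors b p - δ) :=
            mul_le_mul (hΩint _ hb) hVb' (padicNorm.nonneg _) zero_le_one
        _ = _ := one_mul _
    · exact hBb.trans (zpow_le_zpow_right₀ hp1.le (by linarith))

end Summit.KontsevichZagierPeriods.Zeta5Search.ClusterValuation

namespace Summit.KontsevichZagierPeriods.Zeta5Search.RVFlatGauge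

open Summit.KontsevichZagierPeriods.Zeta5Search.CasoratianValuation (casoratian shift InPolytope pairFloors refund)
open Summit.KontsevichZagierPeriods.Zeta5Search.WedgeDictionary (coeffV dOf)
open Summit.KontsevichZagierPeriods.Zeta5Search.ClusterValuation (constantTermFloorLaw_window pairFloors_shift_le)
open Cap

/-! ### The conjecture node (V⁺) and the reduction (V⁺) ⇒ (CV⁺) ⇒ FLAT on (F1) -/

/-- **(V⁺), OBSERVED — the large-parameter constant-term floor** (minted by this cell from exact computation; NOT a published
result; 0 failures over all `b` with `b₀ ≤ 19`, all primes `5 ≤ p ≤ m₁(b)` with at most one long block, all admissible `j`;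
equality in `V(b)` in most instances; equal to THEOREM V `constantTermFloorLaw_window` when all `b_k < p`).  For `b`, `b + e_j`
in the polytope, `p ≥ 5` prime, `b₀ + 2 < p²`, at most one long block:
`v_p V(b) ≥ −N_p(b) + min(nbig, [LP] + [2p ≤ d])` and the same bound for `v_p V(b+e_j)`. -/
@[conjecture] def LargeParamVFloor : Prop :=
  ∀ (b : ℕ → ℤ) (j p i : ℕ), InPolytope b → 1 ≤ j → j ≤ 7 → InPolytope (shift b j) → p.Prime → 5 ≤ p →
    (b 0 + 2 : ℤ) < (p : ℤ) ^ 2 → (∀ k ∈ (range 7).erase i, b 0 - 2 * b (k + 1) < p) →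
    (coeffV b ≠ 0 → -pairFloors b p + lpBonus b p ≤ padicValRat p (coeffV b)) ∧
    (coeffV (shift b j) ≠ 0 → -pairFloors b p + lpBonus b p ≤ padicValRat p (coeffV (shift b j)))

/-- **REDUCTION (PROVED): (V⁺) ⇒ (CV⁺).** -/
theorem largeParamClassLaw_of_vFloor (hV : LargeParamVFloor) : LargeParamClassLaw := by
  intro b j p i hb hj1 hj7 hb' hpr hp5 hwin hshort hcas
  haveI : Fact p.Prime := ⟨hpr⟩
  obtain ⟨h1, h2⟩ := hV b j p i hb hj1 hj7 hb' hpr hp5 hwin hshort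
  exact ClusterValuation.casoratianLaw_of_vBonus b hb hj1 hj7 hb' hp5 hwin
    (fun x _ => ClusterValuation.classPoleCount_le_one_of_short_blocks b hb hpr.pos hshort x) (lpBonus b p) h1 h2 hcas

/-- **(V⁺) ⇒ the flat `S₇`-gauge law for all 5040 labellings on the whole region {at most one long block, `b₀ < 3p`}.** -/
theorem flatGaugeLawF1_of_vFloor (hV : LargeParamVFloor) : FlatGaugeLawF1 :=
  flatGaugeLawF1_of_largeParamClassLaw (largeParamClassLaw_of_vFloor hV)

/-- (V⁺) restricted to gen-7's window (all `b_k < p`, so `nbig = 0` and the bonus vanishes) IS THEOREM V, for `b` and — with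
`N_p(b+e_j) ≤ N_p(b)` — for `b + e_j`. -/
theorem largeParamVFloor_small (b : ℕ → ℤ) {j p : ℕ} (hb : InPolytope b) (hj1 : 1 ≤ j)
    (hb' : InPolytope (shift b j)) (hpr : p.Prime) (hp5 : 5 ≤ p) (hwin : (b 0 + 2 : ℤ) < (p : ℤ) ^ 2)
    (hsmall : ∀ k ∈ range 7, b (k + 1) < p) :
    (coeffV b ≠ 0 → -pairFloors b p + lpBonus b p ≤ padicValRat p (coeffV b)) ∧
    (coeffV (shift b j) ≠ 0 → -pairFloors b p + lpBonus b p ≤ padicValRat p (coeffV (shift b j))) := by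
  rw [lpBonus_eq_zero_of_small hsmall, add_zero]
  refine ⟨fun hVne => constantTermFloorLaw_window b p hb hpr hp5 hwin hVne, fun hVne => ?_⟩
  have hwin' : (shift b j 0 + 2 : ℤ) < (p : ℤ) ^ 2 := by rwa [BigPrime.shift_zero b hj1]
  have h := constantTermFloorLaw_window (shift b j) p hb' hpr hp5 hwin' hVne
  have hN := pairFloors_shift_le b hj1 p hpr.pos
  linarith

/-- Kernel instance of the target exponent: `b = (11;5,5,5,5,5,5,0)`, `p = 5` — one long block (`[0,11]`), `N_5(b) = 6`,
`nbig = 6`, `[LP] = 1`, `d = 3 < 2p`, bonus `1`: (V⁺) claims `v_5 V(b) ≥ −5` (exact value `−5`: the two order-6 poles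
`q = 5, 6` cancel their leading `5⁻⁶` digits in the conjugate pair), one above THEOREM V's `−6`. -/
example :
    let b : ℕ → ℤ := fun k => (([11, 5, 5, 5, 5, 5, 5, 0] : List ℤ)).getD k 0
    pairFloors b 5 = 6 ∧ nbig b 5 = 6 ∧ lpUnit b 5 = 1 ∧ dOf b = 3 ∧ lpBonus b 5 = 1 := by
  decide

end Summit.KontsevichZagierPeriods.Zeta5Search.RVFlatGauge
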